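import Literature.AlgebraicGeometry.Resolution.Hironaka2005JmaxOfCalP
import Mathlib.RingTheory.IntegralClosure.IsIntegralClosure.Basic
import HarnessLib

/-!
# Hironaka 2003/2005: `℘(E)` is integral over its Veronese subalgebras (FACT F-21c) — from the algebraic
# description of `℘(E)` (FACT F-21e)

H. Hironaka, *Theory of infinitely near singular points*, J. Korean Math. Soc. **40** (2003) 901–920 [Hironaka2003]
(2.2) pp.909–910, and *Three key theorems on infinitely near singularities*, Sémin. Congr. **10** (2005) 87–126
[Hironaka2005] §§11–12 («[23]», «[24]» of Hironaka's 2017 manuscript; campaign `res-hironaka`, HIRONAKA-L lane).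
The tree's named fact `Hironaka2005.jmax_veronese` (FACT-LIST F-21c, `Hironaka2005DiffFull.lean`) renders [23] (2.2):
`℘_U(E)` is the integral closure (inside `A[T]`) of its `μ`-Veronese subalgebra `℘_U(E)(μ) = Σ_a J_max(aμ) T^{aμ}`. This
file PROVES it from the named fact `calP_eq_integralClosure_P` (F-21e: `℘(E)` = integral closure of `P(E♯)` in
`A[T]`, [24] §12 p.124 l.44–45):

* `jmax_veronese_of_calP_eq : calP_eq_integralClosure_P → jmax_veronese`.

Proof (standard Veronese argument): under F-21e, `℘ = ℘_{Spec A}(E)` is the set of elements of `A[T]` integral over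
`P(E♯)`, hence a subalgebra of `A[T]`; it is graded (`monomial_coeff_mem_calPAffine`), so for `p ∈ ℘` each homogeneous
component `g Tᵃ ∈ ℘` has `(g Tᵃ)^μ = g^μ T^{aμ} ∈ ℘`, an element supported in degrees divisible by `μ`, whence `g Tᵃ`
(a `μ`-th root of an element of the Veronese subalgebra) and then `p` are integral over it; conversely the Veronese
subalgebra consists of elements integral over `P(E♯)`, so anything integral over it is integral over `P(E♯)`
(transitivity) and lies in `℘`. So F-21c is not an independent premise: of the [23]/[24] §§11–12 facts only F-21e
(`calP_eq_integralClosure_P` / `jmax_flat`, claim (♭)) remains. HONEST FRAMING: a theorem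
`calP_eq_integralClosure_P → jmax_veronese`; nothing of [23]/[24] is asserted unconditionally, nothing of the 2017
manuscript at all.
-/

noncomputable section

open Polynomial

namespace Literature.AlgebraicGeometry.Resolution

universe u

namespace Hironaka2005

/-- **F-21c from F-21e: `℘(E)` is integral over each Veronese subalgebra `℘(E)(μ)`, and integrally closed over it in
`A[T]`** ([23] (2.2) pp.909–910; the tree's `jmax_veronese`), for `A` a domain, smooth of finite type over a perfect field,
`J ⊆ A`, `b ≥ 1`, `μ ≥ 1`, under `h : calP_eq_integralClosure_P` ([24] §12 p.124 l.44–45).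
[cite: Hironaka2003, (2.2) p.909–910] -/
theorem jmax_veronese_of_calP_eq (h : calP_eq_integralClosure_P.{u}) : jmax_veronese.{u} := by
  intro k _ _ A _ _ _ _ _ J b hb μ hμ p
  classical
  -- `℘` = elements integral over `P = P(E♯)`; as a subalgebra `C` of `A[T]`
  let P : Subalgebra A A[X] := PAlg (sharpIdeal k J b) b.factorial
  have hmem : ∀ q : A[X], q ∈ calPAffine J b ↔ IsIntegral P q := fun q => h k A J b hb q
  let C : Subalgebra P A[X] := integralClosure P A[X]
  have hC : ∀ q : A[X], q ∈ calPAffine J b ↔ q ∈ C := fun q => (hmem q).trans Iff.rfl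
  -- the Veronese generating set and subalgebra
  let S : Set A[X] := {q : A[X] | q ∈ calPAffine J b ∧ ∀ a : ℕ, ¬ μ ∣ a → q.coeff a = 0}
  let V : Subalgebra A A[X] := Algebra.adjoin A S
  change p ∈ calPAffine J b ↔ IsIntegral V p
  constructor
  · -- `℘` is integral over `V`: homogeneous components are `μ`-th roots of elements of `S`
    intro hp
    rw [p.as_sum_support]
    refine IsIntegral.sum _ fun a _ => ?_
    have hma : monomial a (p.coeff a) ∈ calPAffine J b := monomial_coeff_mem_calPAffine hp a
    have hpow : monomial a (p.coeff a) ^ μ ∈ S := by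
      refine ⟨?_, fun a' ha' => ?_⟩
      · rw [hC] at hma ⊢
        exact pow_mem hma μ
      · rw [monomial_pow, coeff_monomial, if_neg]
        rintro rfl
        exact ha' (Dvd.intro_left a rfl)
    refine IsIntegral.of_pow hμ ?_
    have : monomial a (p.coeff a) ^ μ = algebraMap V A[X] ⟨_, Algebra.subset_adjoin hpow⟩ := rfl
    rw [this]
    exact isIntegral_algebraMap
  · -- anything integral over `V` is integral over `P(E♯)`, since `V ⊆ C`
    intro hp
    have hVC : ∀ v : V, (v : A[X]) ∈ C := by
      intro v
      have hle : V ≤ C.restrictScalars A := by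
        refine Algebra.adjoin_le ?_
        rintro q ⟨hq, -⟩
        exact (hC q).1 hq
      exact hle v.2
    -- `V → C` and integrality of `p` over `C`
    let i : V →+* C := (V.val : V →+* A[X]).codRestrict C fun v => hVC v
    have hfac : algebraMap V A[X] = (algebraMap C A[X]).comp i := RingHom.ext fun _ => rfl
    have hpC : IsIntegral C p := by
      obtain ⟨q, hq, hq0⟩ := hp
      refine ⟨q.map i, hq.map i, ?_⟩
      rw [Polynomial.eval₂_map, ← hfac]
      exact hq0
    have hpP : IsIntegral P p := isIntegral_trans p hpC
    exact (hmem p).2 hpP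

end Hironaka2005

end Literature.AlgebraicGeometry.Resolution

end
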